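import Literature.Geometry.Kaehler.ComplexTorusInvertibleIdealsClassGroup
import HarnessLib

/-!
# "By Lemma 1.4.4, we indeed have a group action": the class-group action on the quotients `X/H(I)` is
# compatible with composition of ideal isogenies (Kieffer 2024, §1.4.3 with Lemma 1.4.4 — torus level)

Sequel of `ComplexTorusInvertibleIdealsClassGroup` (the injective map
`quotientClass e : ClassGroup R → {complex tori on E}/≅`, `[J] ↦ [X/H(J)]`, for a complex torus
`X = ComplexTorus Φ` whose endomorphism ring is a commutative domain, `e : End(X) ≃+* R`) and of
`ComplexTorusIdealIsogenyComposition` (Kieffer's LEMMA 1.4.4: `φ_{B,J} ∘ φ_{A,I} = φ_{A,Iη(J)}`, i.e.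
`(X/H(I))/H_B(J) ≅ X/H(Iη(J))` for `B = X/H(I)` and `η : End(B) ↪ End⁰(X)`).

> "First, we explain why the class group of `End(A)` acts freely on abelian varieties in the isogeny class
> with endomorphism ring `R`. Let `I` be an invertible ideal in `R`. By Proposition 1.4.7, the endomorphism
> ring of `A/H(I)` is still `R`; by Proposition 1.4.6, `A/H(I)` (up to isomorphism) does not depend on the
> class of `I` in the class group, and `A/H(I) ≃ A` if and only if `I` lies in the trivial class; and by
> Lemma 1.4.4, we indeed have a group action." [Kieffer2024IsogenyGraphs, §1.4.3, p. 47]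
>
> "**Lemma 1.4.4.** Let `I` be an ideal in `End(A)`, let `B = A/H(I)`, and let `J` be an ideal in `End(B)`.
> Let `η : End(B) ↪ End⁰(A)` […]. Then `Iη(J)` is an ideal of `End(A)`, and the composite map
> `φ_{B,J} ∘ φ_{A,I}` is precisely `φ_{A,Iη(J)}`." [Kieffer2024IsogenyGraphs, §1.4.1, p. 44]

For an invertible ideal `I` of the commutative `End(X)`, the quotient `B = X/H(I)` comes with the COMPATIBLE
identification `e_B = e ∘ η : End(B) ≃+* R` ("we can identify endomorphism rings of all abelian varieties
isogenous to `A` as subrings of `End⁰(A)`, simultaneously and in a compatible way" [p. 47];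
`IsInvertibleIdeal.quotientEndRingEquiv`), and under it `Iη(J) = I · η(J)` is the PRODUCT ideal
(`IsInvertibleIdeal.idealMulEta_eq_mul_map`).  Lemma 1.4.4 then says that acting by a class `c` on `B` is
acting by `[I]·c` on `X`:

  `quotientClass e_B c = quotientClass e ([e(I)] · c)`   (`IsInvertibleIdeal.quotientClass_quotient`),

which is the group-action axiom `(c · [I]) ⋆ X = c ⋆ ([I] ⋆ X)` for the commutative group `ClassGroup R`
on the orbit of `[X]`; in particular the orbit does not depend on the base point
(`IsInvertibleIdeal.range_quotientClass_quotient`).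

## Contents (namespace `Literature.Geometry.Kaehler.ComplexTorus`)

* §1 `IsInvertibleIdeal.quotientEndRingEquiv` (`e_B : End(X/H(I)) ≃+* R`), `map_symm_quotientEndRingEquiv`;
  **`IsInvertibleIdeal.idealMulEta_eq_mul_map`** (`Iη(J) = I · η(J)`); `map_comap_trans` (`η(e_B⁻¹ J′) = e⁻¹ J′`).
* §2 **`IsInvertibleIdeal.quotientClass_quotient`** (the action axiom), `IsInvertibleIdeal.quotientClass_quotient_one`,
  `IsInvertibleIdeal.quotientClass_quotient_quotient` (two steps),
  **`IsInvertibleIdeal.range_quotientClass_quotient`** (same orbit from `X` and from `X/H(I)`).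

Theorems and one definition with a body; no named facts.

## References

* [Kieffer2024IsogenyGraphs] J. Kieffer, *Isogeny graphs of abelian varieties over finite fields* (lecture
  notes, 2024), §1.4.1 Lemma 1.4.4 (p. 44), §1.4.3 "Sketch of proof of Theorem 2" (p. 47), Theorem 2 (p. 2).
* [ArpinMarsegliaSpringer2025] S. Arpin, S. Marseglia, C. Springer, *Isogeny graphs of abelian varieties and
  singular ideals in orders* (arXiv:2508.03570), Prop. 6.10 (p. 15): "`Cl(S)` acts […] on the set of
  isomorphism classes of abelian varieties with endomorphism ring `S` and that this action is free".
-/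

noncomputable section

open Module Function
open scoped Matrix nonZeroDivisors

namespace Literature.Geometry.Kaehler

namespace ComplexTorus

variable {ι : Type*} [Fintype ι] [DecidableEq ι] {E : Type*} [NormedAddCommGroup E] [NormedSpace ℂ E]
  {Φ : (ι → ℝ) ≃L[ℝ] E}

omit [DecidableEq ι] in
/-- Entrywise cast `ℤ → ℚ` of a product. [folklore] -/
private theorem map_intCast_mul_rat' (A B : Matrix ι ι ℤ) :
    (A * B).map (Int.cast : ℤ → ℚ) = A.map (Int.cast : ℤ → ℚ) * B.map (Int.cast : ℤ → ℚ) :=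
  Matrix.map_mul (f := Int.castRingHom ℚ)

/-! ## §1 The compatible identification `e_B : End(X/H(I)) ≃+* R` and `Iη(J) = I · η(J)` -/

section Compatible

variable {R : Type*} [CommRing R]

/-- **The compatible identification `e_B = e ∘ η : End(X/H(I)) ≃+* R`** of the endomorphism ring of the
quotient by an invertible ideal ("we can identify endomorphism rings of all abelian varieties isogenous to
`A` as subrings of `End⁰(A)`, simultaneously and in a compatible way … By Proposition 1.4.7, the
endomorphism ring of `A/H(I)` is still `R`"). A DEFINITION with a body.
[cite: Kieffer2024IsogenyGraphs, §1.4.3 (sketch of proof of Theorem 2), p. 47] -/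
def IsInvertibleIdeal.quotientEndRingEquiv (e : endRingInt Φ ≃+* R) {I : Ideal (endRingInt Φ)}
    (hI : IsInvertibleIdeal Φ I) [Finite (kernelSubgroup Φ I)] :
    endRingInt (quotientByPeriod Φ (kernelSubgroup Φ I)) ≃+* R :=
  (hI.quotientEndEquiv (endAlgRat_mul_comm_of_ringEquiv e)).trans e

/-- `e_B` is `e ∘ η` on matrices: `(e⁻¹ (e_B γ))_ℚ = η(γ)`. [cite: Kieffer2024IsogenyGraphs, §1.4.3 (sketch of proof of Theorem 2) with §1.4.1 Prop. 1.4.7, pp. 45–47] -/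
theorem IsInvertibleIdeal.map_symm_quotientEndRingEquiv (e : endRingInt Φ ≃+* R) {I : Ideal (endRingInt Φ)}
    (hI : IsInvertibleIdeal Φ I) [Finite (kernelSubgroup Φ I)]
    (γ : endRingInt (quotientByPeriod Φ (kernelSubgroup Φ I))) :
    ((e.symm (hI.quotientEndRingEquiv e γ) : endRingInt Φ) : Matrix ι ι ℤ).map (Int.cast : ℤ → ℚ) =
      quotientEndHom Φ (kernelSubgroup Φ I) γ := by
  rw [IsInvertibleIdeal.quotientEndRingEquiv, RingEquiv.trans_apply, RingEquiv.symm_apply_apply]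
  exact hI.coe_quotientEndEquiv _ γ

/-- **`Iη(J) = I · η(J)`**: for an invertible ideal `I` of a commutative `End(X)`, Kieffer's ideal `Iη(J)`
(spanned by the `σ·η(τ)`, `σ ∈ I`, `τ ∈ J`) is the product of `I` with the image of `J` under
`η : End(X/H(I)) ≅ End(X)` (`IsInvertibleIdeal.quotientEndEquiv`).
[cite: Kieffer2024IsogenyGraphs, §1.4.1 Lemma 1.4.4 ("`Iη(J)` is an ideal of `End(A)`") with §1.4.3, pp. 44, 47] -/
theorem IsInvertibleIdeal.idealMulEta_eq_mul_map {I : Ideal (endRingInt Φ)} (hI : IsInvertibleIdeal Φ I)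
    (hcomm : ∀ M ∈ endAlgRat Φ, ∀ N ∈ endAlgRat Φ, M * N = N * M) [Finite (kernelSubgroup Φ I)]
    (J : Ideal (endRingInt (quotientByPeriod Φ (kernelSubgroup Φ I)))) :
    idealMulEta Φ I J = I * J.map (hI.quotientEndEquiv hcomm) := by
  refine le_antisymm (Ideal.span_le.2 ?_) (Ideal.mul_le.2 fun σ hσ β hβ ↦ ?_)
  · rintro α ⟨σ, hσ, τ, hτ, hα⟩
    have hαeq : α = σ * hI.quotientEndEquiv hcomm τ := by
      apply Subtype.ext
      apply Matrix.map_injective (Int.cast_injective (α := ℚ))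
      change (α : Matrix ι ι ℤ).map (Int.cast : ℤ → ℚ) =
        ((σ * hI.quotientEndEquiv hcomm τ : endRingInt Φ) : Matrix ι ι ℤ).map (Int.cast : ℤ → ℚ)
      rw [hα, Subring.coe_mul, map_intCast_mul_rat', hI.coe_quotientEndEquiv hcomm τ]
    rw [SetLike.mem_coe, hαeq]
    exact Ideal.mul_mem_mul hσ (Ideal.mem_map_of_mem _ hτ)
  · obtain ⟨τ, hτ, rfl⟩ := (Ideal.mem_map_of_equiv (hI.quotientEndEquiv hcomm) β).1 hβ
    exact mem_idealMulEta_of_coe_eq Φ I J hσ hτ (by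
      rw [Subring.coe_mul, map_intCast_mul_rat', hI.coe_quotientEndEquiv hcomm τ])

/-- Transport of an ideal `J′ ⊆ R` along `e_B = e ∘ ψ`: `ψ(e_B⁻¹ J′) = e⁻¹ J′`. [folklore] -/
private theorem map_comap_trans {S : Type*} [Ring S] (ψ : S ≃+* endRingInt Φ) (e : endRingInt Φ ≃+* R)
    (J' : Ideal R) : (J'.comap (ψ.trans e)).map ψ = J'.comap e := by
  ext x
  constructor
  · intro hx
    obtain ⟨y, hy, rfl⟩ := (Ideal.mem_map_of_equiv ψ x).1 hx
    exact hy
  · intro hx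
    refine (Ideal.mem_map_of_equiv ψ x).2 ⟨ψ.symm x, ?_, ψ.apply_symm_apply x⟩
    change (ψ.trans e) (ψ.symm x) ∈ J'
    rwa [RingEquiv.trans_apply, RingEquiv.apply_symm_apply]

end Compatible

/-! ## §2 The action axiom: acting by `c` on `X/H(I)` is acting by `[I]·c` on `X` -/

section Action

variable {R : Type*} [CommRing R] [IsDomain R] (e : endRingInt Φ ≃+* R)
  (K : Type*) [Field K] [Algebra R K] [IsFractionRing R K]

omit [IsDomain R] in
/-- `Ideal.map e` is injective for a ring isomorphism `e`. [folklore] -/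
private theorem map_injective_of_ringEquiv' : Function.Injective (Ideal.map e : Ideal (endRingInt Φ) → Ideal R) :=
  fun I J h ↦ by rw [← Ideal.comap_map_of_bijective e e.bijective (I := I), h, Ideal.comap_map_of_bijective e e.bijective]

/-- **LEMMA 1.4.4 in the class group ("by Lemma 1.4.4, we indeed have a group action"): for an invertible
ideal `I ⊆ End(X)`, `B = X/H(I)` with its compatible identification `e_B : End(B) ≃+* R`, and every class
`c ∈ Cl(R) = ClassGroup R`, acting by `c` on `B` gives the same torus, up to isomorphism, as acting by
`[e(I)]·c` on `X`: `quotientClass e_B c = quotientClass e ([e(I)]·c)`** — for `c = [J′]`: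
`B/H_B(e_B⁻¹J′) ≅ X/H(Iη(e_B⁻¹J′)) = X/H(I · e⁻¹J′)`.
[cite: Kieffer2024IsogenyGraphs, §1.4.3 (sketch of proof of Theorem 2: "and by Lemma 1.4.4, we indeed have a group action") with §1.4.1 Lemma 1.4.4, pp. 44, 47] -/
theorem IsInvertibleIdeal.quotientClass_quotient {I : Ideal (endRingInt Φ)} (hI : IsInvertibleIdeal Φ I)
    [Finite (kernelSubgroup Φ I)] {u : (FractionalIdeal R⁰ K)ˣ}
    (hu : (u : FractionalIdeal R⁰ K) = ((I.map e : Ideal R) : FractionalIdeal R⁰ K)) (c : ClassGroup R) :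
    quotientClass (hI.quotientEndRingEquiv e) c = quotientClass e (ClassGroup.mk K u * c) := by
  set hcomm := endAlgRat_mul_comm_of_ringEquiv e with hcomm_def
  set ψ : endRingInt (quotientByPeriod Φ (kernelSubgroup Φ I)) ≃+* endRingInt Φ := hI.quotientEndEquiv hcomm
    with hψ
  have heB : hI.quotientEndRingEquiv e = ψ.trans e := rfl
  -- move `u` to the fraction field `FractionRing R`
  set w : (FractionalIdeal R⁰ (FractionRing R))ˣ :=
    Units.map (↑(FractionalIdeal.canonicalEquiv R⁰ K (FractionRing R))) u with hw_def
  have hw : (w : FractionalIdeal R⁰ (FractionRing R)) =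
      ((I.map e : Ideal R) : FractionalIdeal R⁰ (FractionRing R)) := by
    rw [hw_def, Units.coe_map, MonoidHom.coe_coe, hu, FractionalIdeal.canonicalEquiv_coeIdeal]
  rw [← ClassGroup.mk_canonicalEquiv K (FractionRing R) u]
  refine ClassGroup.induction (FractionRing R) (fun v ↦ ?_) c
  -- integral representatives: `J_X = e⁻¹(num v)` on `X`, `J_B = e_B⁻¹(num v)` on `B`, `ψ(J_B) = J_X`
  set JX : Ideal (endRingInt Φ) := repIdeal e (FractionRing R) v with hJX
  set JB : Ideal (endRingInt (quotientByPeriod Φ (kernelSubgroup Φ I))) :=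
    repIdeal (hI.quotientEndRingEquiv e) (FractionRing R) v with hJB
  have hJBX : JB.map ψ = JX := by
    rw [hJB, hJX, repIdeal, repIdeal, heB]
    exact map_comap_trans ψ e _
  have hJXinv : IsInvertibleIdeal Φ JX := isInvertibleIdeal_repIdeal e (FractionRing R) v
  have hJBinv : IsInvertibleIdeal (quotientByPeriod Φ (kernelSubgroup Φ I)) JB :=
    isInvertibleIdeal_repIdeal (hI.quotientEndRingEquiv e) (FractionRing R) v
  haveI : Finite (kernelSubgroup (quotientByPeriod Φ (kernelSubgroup Φ I)) JB) := hJBinv.finite_kernelSubgroup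
  -- a unit `v''` with value `e(J_X)` and the same class as `v`
  have hJXunit : IsUnit (((JX.map e : Ideal R)) : FractionalIdeal R⁰ (FractionRing R)) :=
    (isInvertibleIdeal_iff_isUnit_coeIdeal e (FractionRing R)).1 hJXinv
  haveI : Finite (kernelSubgroup Φ JX) := hJXinv.finite_kernelSubgroup
  have hvv : ClassGroup.mk (FractionRing R) hJXunit.unit = ClassGroup.mk (FractionRing R) v := by
    apply quotientClass_injective e
    rw [quotientClass_mk e (FractionRing R) (IsUnit.unit_spec hJXunit), quotientClass_mk_fractionRing]
    rfl
  -- the product ideal `I · J_X` is invertible, with unit `w · v''`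
  have hprod : ((w * hJXunit.unit : (FractionalIdeal R⁰ (FractionRing R))ˣ) : FractionalIdeal R⁰ (FractionRing R)) =
      (((I * JX).map e : Ideal R) : FractionalIdeal R⁰ (FractionRing R)) := by
    rw [Units.val_mul, hw, IsUnit.unit_spec, Ideal.map_mul, FractionalIdeal.coeIdeal_mul]
  have hIJinv : IsInvertibleIdeal Φ (I * JX) :=
    (isInvertibleIdeal_iff_isUnit_coeIdeal e (FractionRing R)).2 (hprod ▸ (w * hJXunit.unit).isUnit)
  haveI : Finite (kernelSubgroup Φ (I * JX)) := hIJinv.finite_kernelSubgroup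
  -- both sides are classes of explicit quotients
  rw [← hvv, ← map_mul, quotientClass_mk e (FractionRing R) hprod, hvv, quotientClass_mk_fractionRing]
  apply Quotient.sound
  change IsIsomorphic (quotientByPeriod (quotientByPeriod Φ (kernelSubgroup Φ I))
      (kernelSubgroup (quotientByPeriod Φ (kernelSubgroup Φ I)) JB))
    (quotientByPeriod Φ (kernelSubgroup Φ (I * JX)))
  -- Lemma 1.4.4: `B/H_B(J_B) ≅ X/H(Iη(J_B))`, and `Iη(J_B) = I · ψ(J_B) = I · J_X`
  have hmul : idealMulEta Φ I JB = I * JX := by rw [hI.idealMulEta_eq_mul_map hcomm, hJBX]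
  exact (isIsomorphic_quotient_idealMulEta Φ I JB).symm.trans
    (isIsomorphic_quotientByPeriod_of_eq Φ (congrArg (kernelSubgroup Φ) hmul))

/-- The case `c = 1`: `quotientClass e_B 1 = [B] = quotientClass e [e(I)]` (consistency of the base points).
[cite: Kieffer2024IsogenyGraphs, §1.4.3 (sketch of proof of Theorem 2), p. 47] -/
theorem IsInvertibleIdeal.quotientClass_quotient_one {I : Ideal (endRingInt Φ)} (hI : IsInvertibleIdeal Φ I)
    [Finite (kernelSubgroup Φ I)] {u : (FractionalIdeal R⁰ K)ˣ}
    (hu : (u : FractionalIdeal R⁰ K) = ((I.map e : Ideal R) : FractionalIdeal R⁰ K)) :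
    quotientClass (hI.quotientEndRingEquiv e) 1 = quotientClass e (ClassGroup.mk K u) := by
  rw [hI.quotientClass_quotient e K hu 1, mul_one]


/-- **Two steps compose ("we indeed have a group action"):** for `I ⊆ End(X)` invertible, `B = X/H(I)` with
`e_B`, and `J ⊆ End(B)` invertible, `C = B/H_B(J)` with `e_C`, acting by `c` on `C` is acting by
`[e(I)]·[e_B(J)]·c` on `X`. [cite: Kieffer2024IsogenyGraphs, §1.4.3 (sketch of proof of Theorem 2: "and by Lemma 1.4.4, we indeed have a group action"), p. 47] -/
theorem IsInvertibleIdeal.quotientClass_quotient_quotient {I : Ideal (endRingInt Φ)} (hI : IsInvertibleIdeal Φ I)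
    [Finite (kernelSubgroup Φ I)]
    {J : Ideal (endRingInt (quotientByPeriod Φ (kernelSubgroup Φ I)))}
    (hJ : IsInvertibleIdeal (quotientByPeriod Φ (kernelSubgroup Φ I)) J)
    [Finite (kernelSubgroup (quotientByPeriod Φ (kernelSubgroup Φ I)) J)]
    {u v : (FractionalIdeal R⁰ K)ˣ}
    (hu : (u : FractionalIdeal R⁰ K) = ((I.map e : Ideal R) : FractionalIdeal R⁰ K))
    (hv : (v : FractionalIdeal R⁰ K) = ((J.map (hI.quotientEndRingEquiv e) : Ideal R) : FractionalIdeal R⁰ K))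
    (c : ClassGroup R) :
    quotientClass (hJ.quotientEndRingEquiv (hI.quotientEndRingEquiv e)) c =
      quotientClass e (ClassGroup.mk K u * ClassGroup.mk K v * c) := by
  rw [hJ.quotientClass_quotient (hI.quotientEndRingEquiv e) K hv, hI.quotientClass_quotient e K hu, mul_assoc]

/-- **The orbit does not depend on the base point**: the classes of tori reached from `B = X/H(I)` (with `e_B`)
are exactly those reached from `X` (with `e`) — `c ↦ [e(I)]·c` is a bijection of `ClassGroup R`.
[cite: Kieffer2024IsogenyGraphs, §1.4.3 (sketch of proof of Theorem 2: "we indeed have a group action"; Theorem 2: "principal homogeneous space"), pp. 2, 47] -/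
theorem IsInvertibleIdeal.range_quotientClass_quotient {I : Ideal (endRingInt Φ)} (hI : IsInvertibleIdeal Φ I)
    [Finite (kernelSubgroup Φ I)] :
    Set.range (quotientClass (hI.quotientEndRingEquiv e)) = Set.range (quotientClass e) := by
  have hIunit := (isInvertibleIdeal_iff_isUnit_coeIdeal e (FractionRing R)).1 hI
  set u : (FractionalIdeal R⁰ (FractionRing R))ˣ := hIunit.unit with hu_def
  have hu : (u : FractionalIdeal R⁰ (FractionRing R)) = ((I.map e : Ideal R) : FractionalIdeal R⁰ (FractionRing R)) :=
    IsUnit.unit_spec hIunit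
  ext q
  constructor
  · rintro ⟨c, rfl⟩
    exact ⟨ClassGroup.mk (FractionRing R) u * c, (hI.quotientClass_quotient e (FractionRing R) hu c).symm⟩
  · rintro ⟨c, rfl⟩
    refine ⟨(ClassGroup.mk (FractionRing R) u)⁻¹ * c, ?_⟩
    rw [hI.quotientClass_quotient e (FractionRing R) hu, mul_inv_cancel_left]

end Action

end ComplexTorus

end Literature.Geometry.Kaehler
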